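import Mathlib
import HarnessLib
import Summits.NavierStokesRegularity.NavierStokesRegularity.Theorems.CompletionRelayChainRelayFrontStepIgnitionClock

/-!
# `CompletionRelayChain` — crux `RelayFrontStep` (item stmt-NavierStokesRegularity-24850), LINE `window_v2`,
  registered stub `stub_ignition` (Phase II): THE IGNITION CLOCK, relay and time recurrences on one piece

Continuation of `…RelayFrontStepIgnitionClock` (blueprint `IGNITION-BLUEPRINT-crc-p2.md` §3, evidence on the item).
On a piece `[a, b] ⊆ [0, τ]` on which the next trigger `u` obeys `u′ ≥ Λ m′ u` and `w_a ≤ u ≤ w_b`: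
* `clock_integral_u_le` — `∫_a^b Λ u ≤ (u(b) − u(a))/m′` (the `√v`-weighted form of the clock);
* `clock_piece_time` — `b − a ≤ log(w_b/w_a)/(Λ m′)` (recurrence `Δs_j` of the blueprint);
* `clock_piece_r1` — if `r′ ≤ (Λ/32)·u·X + ε` on the piece (relay row with `x₂ ≤ X`, `u₂ ≥ 0` dropped), then
  `r(b) ≤ r(a) + X (w_b − w_a)/(32 m′) + ε (b − a)` (recurrence `R₁(j+1)` of the blueprint);
* `clock_piece_linear` — a one-sided linear comparison `y′ ≤ K y + β`, `K ≥ 0` ⇒ `y(t) ≤ (y(a) + β(t−a))·e^{K(t−a)}` for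
  `y(a) + β(t − a) ≥ 0` (used for the trigger of old shell 2, recurrence `U₂(j+1)`).
Plain real functions, `C¹` on `Icc 0 τ`, one-sided `derivWithin` bounds — exactly what `TaoCascade.PseudoFlowOn` supplies.

No definitions. HONEST FRAMING: elementary calculus for MODEL-lattice bookkeeping; helper for the crux, no stub credit;
nothing here is a statement about the Navier–Stokes equations.
-/

noncomputable section

-- the summit-side namespace `Summit.NavierStokesRegularity.NavierStokesRegularity.…` (single-conjunct summit,
-- D-0017) repeats a component by design; the dupNamespace linter would flag every declaration.
set_option linter.dupNamespace false

open Set MeasureTheory intervalIntegral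

namespace Summit.NavierStokesRegularity.NavierStokesRegularity.Cruxes.RelayFrontStep.Window2

/-- **Clock integral, first-order form.** On `[a,b] ⊆ [0,τ]`: `u` `C¹` on `[0,τ]`, `derivWithin u ≥ Λ m′ u` on `[a,b]`
(`m′ > 0`) ⇒ `∫_a^b Λ u ≤ (u(b) − u(a))/m′`. [folklore] -/
theorem clock_integral_u_le {u : ℝ → ℝ} {τ a b Λ m' : ℝ} (hτ : 0 < τ) (hu : ContDiffOn ℝ 1 u (Icc 0 τ))
    (ha : 0 ≤ a) (hab : a ≤ b) (hb : b ≤ τ) (hm : 0 < m')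
    (hgrow : ∀ s ∈ Icc a b, Λ * m' * u s ≤ derivWithin u (Icc 0 τ) s) :
    (∫ s in a..b, Λ * u s) ≤ (u b - u a) / m' := by
  have hsubI : Icc a b ⊆ Icc 0 τ := Icc_subset_Icc ha hb
  have hf : ContDiffOn ℝ 1 (fun x => u x / m') (Icc 0 τ) := hu.div_const _
  have hg : ContinuousOn (fun s => Λ * u s) (Icc a b) := continuousOn_const.mul (hu.continuousOn.mono hsubI)
  have key : ∀ s ∈ Icc a b, Λ * u s ≤ derivWithin (fun x => u x / m') (Icc 0 τ) s := by
    intro s hs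
    have hsI : s ∈ Icc 0 τ := hsubI hs
    have hud : DifferentiableWithinAt ℝ u (Icc 0 τ) s := (hu.differentiableOn one_ne_zero) s hsI
    have huniq : UniqueDiffWithinAt ℝ (Icc 0 τ) s := uniqueDiffOn_Icc hτ s hsI
    have hder : HasDerivWithinAt (fun x => u x / m') (derivWithin u (Icc 0 τ) s / m') (Icc 0 τ) s :=
      hud.hasDerivWithinAt.div_const m'
    rw [hder.derivWithin huniq, le_div_iff₀ hm]
    have := hgrow s hs
    nlinarith
  have h := integral_le_increment_of_le_derivWithin hτ hf hg ha hab hb key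
  have e1 : u b / m' - u a / m' = (u b - u a) / m' := by ring
  rw [e1] at h
  exact h

/-- **Time spent on a piece.** If `u′ ≥ Λ m′ u` on `[a,b] ⊆ [0,τ]` with `Λ m′ > 0`, `u(a) ≥ w_a > 0` and `u(b) ≤ w_b`, then
`b − a ≤ log(w_b/w_a)/(Λ m′)`. [folklore] -/
theorem clock_piece_time {u : ℝ → ℝ} {τ a b Λ m' wa wb : ℝ} (hu : ContDiffOn ℝ 1 u (Icc 0 τ))
    (ha : 0 ≤ a) (hab : a ≤ b) (hb : b ≤ τ) (hΛm : 0 < Λ * m') (hwa : 0 < wa) (hua : wa ≤ u a) (hub : u b ≤ wb)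
    (hgrow : ∀ s ∈ Icc a b, Λ * m' * u s ≤ derivWithin u (Icc 0 τ) s) :
    b - a ≤ Real.log (wb / wa) / (Λ * m') := by
  have hua0 : 0 < u a := lt_of_lt_of_le hwa hua
  have h := clock_time_le (c := Λ * m') hu ha hab hb hΛm hua0
    (fun s hs => by have := hgrow s hs; linarith) (right_mem_Icc.mpr hab) hub
  refine h.trans (div_le_div_of_nonneg_right ?_ hΛm.le)
  have hgrow' : ∀ s ∈ Icc a b, Λ * m' * u s ≤ derivWithin u (Icc 0 τ) s := hgrow
  have hub0 : 0 < u b := by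
    have hg := clock_exp_growth (c := Λ * m') hu ha hab hb (fun s hs => by have := hgrow' s hs; linarith)
      b (right_mem_Icc.mpr hab)
    exact lt_of_lt_of_le (mul_pos hua0 (Real.exp_pos _)) hg
  have hwb : 0 < wb := lt_of_lt_of_le hub0 hub
  apply Real.log_le_log (div_pos hwb hua0)
  exact div_le_div_of_nonneg_left hwb.le hwa hua

/-- **Relay recurrence on a piece** (blueprint §3, `R₁(j+1) = R₁(j) + X₂(j+1)(w_{j+1} − w_j)/(32 m_j)`): on
`[a,b] ⊆ [0,τ]`, if `r′ ≤ (Λ/32)·u·X + ε` and `u′ ≥ Λ m′ u` with `u(a) ≥ w_a`, `u(b) ≤ w_b`, `X ≥ 0`, then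
`r(b) ≤ r(a) + X (w_b − w_a)/(32 m′) + ε (b − a)`. [folklore] -/
theorem clock_piece_r1 {u r : ℝ → ℝ} {τ a b Λ m' wa wb X ε : ℝ} (hτ : 0 < τ) (hu : ContDiffOn ℝ 1 u (Icc 0 τ))
    (hr : ContDiffOn ℝ 1 r (Icc 0 τ)) (ha : 0 ≤ a) (hab : a ≤ b) (hb : b ≤ τ) (hm : 0 < m') (hX : 0 ≤ X)
    (hua : wa ≤ u a) (hub : u b ≤ wb)
    (hgrow : ∀ s ∈ Icc a b, Λ * m' * u s ≤ derivWithin u (Icc 0 τ) s)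
    (hr' : ∀ s ∈ Icc a b, derivWithin r (Icc 0 τ) s ≤ Λ / 32 * u s * X + ε) :
    r b ≤ r a + X * (wb - wa) / (32 * m') + ε * (b - a) := by
  have hsubI : Icc a b ⊆ Icc 0 τ := Icc_subset_Icc ha hb
  have hcont : ContinuousOn (fun s => Λ / 32 * u s * X + ε) (Icc a b) :=
    ((continuousOn_const.mul (hu.continuousOn.mono hsubI)).mul continuousOn_const).add continuousOn_const
  have hinc := increment_le_integral_of_derivWithin_le hτ hr hcont ha hab hb hr'
  have hi1 : IntervalIntegrable (fun s => Λ * u s) volume a b :=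
    ((continuousOn_const.mul (hu.continuousOn.mono hsubI)).mono (by rw [uIcc_of_le hab])).intervalIntegrable
  have hsplit : (∫ s in a..b, Λ / 32 * u s * X + ε) = X / 32 * (∫ s in a..b, Λ * u s) + ε * (b - a) := by
    have e : (fun s => Λ / 32 * u s * X + ε) = fun s => X / 32 * (Λ * u s) + ε := by funext s; ring
    rw [e, intervalIntegral.integral_add (hi1.const_mul _) (by simp), intervalIntegral.integral_const_mul,
      intervalIntegral.integral_const, smul_eq_mul, mul_comm (b - a)]
  rw [hsplit] at hinc
  have hI := clock_integral_u_le hτ hu ha hab hb hm hgrow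
  have hI' : (∫ s in a..b, Λ * u s) ≤ (wb - wa) / m' := hI.trans (div_le_div_of_nonneg_right (by linarith) hm.le)
  have hX32 : 0 ≤ X / 32 := by positivity
  have := mul_le_mul_of_nonneg_left hI' hX32
  have e2 : X / 32 * ((wb - wa) / m') = X * (wb - wa) / (32 * m') := by field_simp
  linarith [e2 ▸ this]

/-- **One-sided linear comparison on a piece** (for old shell 2's trigger, blueprint `U₂(j+1)`): on `[a,b] ⊆ [0,τ]`,
if `y` is `C¹` on `[0,τ]`, `derivWithin y ≤ K y + β` on `[a,b]` with `K ≥ 0`, then for every `t ∈ [a,b]`,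
`y(t) ≤ (y(a) + β (t − a)) · exp(K (t − a))` provided `y(a) + β(t − a) ≥ 0` and `β ≥ 0`. (Proof: `z := y·e^{−K(t−a)}`
has `z′ ≤ β e^{−K(t−a)} ≤ β`.) [folklore] -/
theorem clock_piece_linear {y : ℝ → ℝ} {τ a b K β : ℝ} (hy : ContDiffOn ℝ 1 y (Icc 0 τ))
    (ha : 0 ≤ a) (hab : a ≤ b) (hb : b ≤ τ) (hK : 0 ≤ K) (hβ : 0 ≤ β)
    (hy' : ∀ s ∈ Icc a b, derivWithin y (Icc 0 τ) s ≤ K * y s + β) :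
    ∀ t ∈ Icc a b, y t ≤ (y a + β * (t - a)) * Real.exp (K * (t - a)) := by
  have hsubI : Icc a b ⊆ Icc 0 τ := Icc_subset_Icc ha hb
  -- z(t) := y(t) e^{−K(t−a)} − β (t − a) is antitone on [a,b]
  set z : ℝ → ℝ := fun t => y t * Real.exp ((-K) * (t - a)) - β * (t - a) with hz
  have hE : ∀ t, HasDerivAt (fun t => Real.exp ((-K) * (t - a))) (Real.exp ((-K) * (t - a)) * (-K)) t := by
    intro t
    have h1 : HasDerivAt (fun t => (-K) * (t - a)) (-K) t := by
      simpa using ((hasDerivAt_id t).sub_const a).const_mul (-K)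
    exact (Real.hasDerivAt_exp _).comp t h1
  have hL : ∀ t, HasDerivAt (fun t => β * (t - a)) β t := by
    intro t; simpa using ((hasDerivAt_id t).sub_const a).const_mul β
  have hzc : ContinuousOn z (Icc a b) :=
    ((hy.continuousOn.mono hsubI).mul (fun t _ => (hE t).continuousAt.continuousWithinAt)).sub
      (fun t _ => (hL t).continuousAt.continuousWithinAt)
  have hzd : DifferentiableOn ℝ z (interior (Icc a b)) := by
    rw [interior_Icc]; intro t ht
    have htI : Icc 0 τ ∈ nhds t := Icc_mem_nhds (lt_of_le_of_lt ha ht.1) (lt_of_lt_of_le ht.2 hb)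
    have hyd : DifferentiableAt ℝ y t := ((hy.differentiableOn one_ne_zero) t (hsubI ⟨ht.1.le, ht.2.le⟩)).differentiableAt htI
    exact ((hyd.mul (hE t).differentiableAt).sub (hL t).differentiableAt).differentiableWithinAt
  have hz' : ∀ t ∈ interior (Icc a b), deriv z t ≤ 0 := by
    rw [interior_Icc]; intro t ht
    have htI : Icc 0 τ ∈ nhds t := Icc_mem_nhds (lt_of_le_of_lt ha ht.1) (lt_of_lt_of_le ht.2 hb)
    have hmem : t ∈ Icc 0 τ := hsubI ⟨ht.1.le, ht.2.le⟩
    have hyd : DifferentiableWithinAt ℝ y (Icc 0 τ) t := (hy.differentiableOn one_ne_zero) t hmem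
    have hyda : HasDerivAt y (derivWithin y (Icc 0 τ) t) t := by
      rw [derivWithin_of_mem_nhds htI]; exact (hyd.differentiableAt htI).hasDerivAt
    have hder : HasDerivAt z (derivWithin y (Icc 0 τ) t * Real.exp ((-K) * (t - a)) +
        y t * (Real.exp ((-K) * (t - a)) * (-K)) - β) t := (hyda.mul (hE t)).sub (hL t)
    rw [hder.deriv]
    have hpos : 0 < Real.exp ((-K) * (t - a)) := Real.exp_pos _
    have hle1 : Real.exp ((-K) * (t - a)) ≤ 1 := by
      rw [Real.exp_le_one_iff]; nlinarith [ht.1.le]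
    have h1 := hy' t ⟨ht.1.le, ht.2.le⟩
    -- (y' − K y) e^{..} ≤ β e^{..} ≤ β
    have h2 : (derivWithin y (Icc 0 τ) t - K * y t) * Real.exp ((-K) * (t - a)) ≤ β * Real.exp ((-K) * (t - a)) :=
      mul_le_mul_of_nonneg_right (by linarith) hpos.le
    have h3 : β * Real.exp ((-K) * (t - a)) ≤ β := by nlinarith
    nlinarith
  have hanti : AntitoneOn z (Icc a b) := antitoneOn_of_deriv_nonpos (convex_Icc a b) hzc hzd hz'
  intro t ht
  have h1 := hanti (left_mem_Icc.mpr hab) ht ht.1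
  simp only [hz, sub_self, mul_zero, Real.exp_zero, mul_one, sub_zero] at h1
  -- y t e^{−K(t−a)} − β(t−a) ≤ y a  ⇒  y t ≤ (y a + β(t−a)) e^{K(t−a)}
  have hpos : 0 < Real.exp (K * (t - a)) := Real.exp_pos _
  have e : Real.exp ((-K) * (t - a)) * Real.exp (K * (t - a)) = 1 := by
    rw [← Real.exp_add]; simp
  have h2 : y t * Real.exp ((-K) * (t - a)) ≤ y a + β * (t - a) := by linarith
  calc y t = (y t * Real.exp ((-K) * (t - a))) * Real.exp (K * (t - a)) := by rw [mul_assoc, e, mul_one]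
    _ ≤ (y a + β * (t - a)) * Real.exp (K * (t - a)) := mul_le_mul_of_nonneg_right h2 hpos.le

end Summit.NavierStokesRegularity.NavierStokesRegularity.Cruxes.RelayFrontStep.Window2
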